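import Literature.Analysis.FluidPDE.PassiveScalarEnergySlice
import Literature.Analysis.FluidPDE.PassiveScalarEnergyMollified
import Literature.Analysis.FunctionSpaces.TorusRademacher
import HarnessLib

/-!
# Pairing the mollified passive-scalar equation with a Lipschitz weight

Analysis/FluidPDE proof-support file (everything proved; one auxiliary `def`). For a weak solution
`θ` of `∂ₜθ + u·∇θ = κΔθ` on `T^d × [0,T)` (`Torus.IsWeakScalarTransportOn`), a smooth kernel `k`,
the mollified solution `A = θ ⋆ k` and its flux `G(s,x) = ∫ θ(s,y) (-⟪u(s,y), ∇k(x-y)⟫ + κ Δk(x-y)) dy`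
(`PassiveScalarEnergyMollified`), and a Lipschitz weight `ζ : T^d → ℝ` (a Kantorovich potential
of Seis 2022, §2.2), we provide:

* `Torus.integral_mul_transport_eq_neg_integral_inner` — slice identity for the transport part,
  `∫ ζ(x) ∫ θ(y)⟪v(y), ∇k(x-y)⟫ dy dx = -∫ ⟪V(x), ∇ζ(x)⟫ dx` with the mollified momentum
  `V(x) = ∫ θ(y) k(x-y) v(y) dy` (Fubini twice, oddness of `∇k`, and the tree's
  `Torus.gradient_convolution_of_lipschitz`, `∇(ζ ⋆ k) = k ⋆ ∇ζ` for Lipschitz `ζ`);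
* `Torus.integral_mul_diffusion_eq` — `∫ ζ(x) ∫ θ(y) Δk(x-y) dy dx = ∫ θ Δ(ζ ⋆ k)` (evenness of `Δk`);
* `Torus.integral_mul_flux_eq` — hence `∫ ζ G = ∫ ⟪V, ∇ζ⟫ + κ ∫ θ Δ(ζ ⋆ k)`, i.e. the weak
  formulation tested with `ζ ⋆ k`, with the transport term in momentum form;
* `Torus.IsWeakScalarTransportOn.molRep` — the everywhere-in-time representative
  `Ã(t,x) = (θ₀ ⋆ k)(x) + ∫_{(0,t]} G(s,x) ds` of `A` (equal to `A(t,·)` for a.e. `t`,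
  `ae_molRep_eq`), continuous in `x`, and the time-increment formula
  `∫ w Ã(t) - ∫ w Ã(t') = ∫_{(t',t]} ∫ w G` for bounded weights `w` with its bound
  `≤ C_w ∫_{(t',t]} bound` (`integral_mul_molRep_sub`, `abs_integral_mul_molRep_sub_le`), which
  makes `t ↦ ∫ ζ Ã(t)` absolutely continuous uniformly in `ζ`.

These are the Eulerian ingredients of the derivative of `D_δ(θ(t))` in Seis 2022, Lemma 3.

## References

* C. Seis, Comm. Math. Phys. 2022 (arXiv:2003.08794), Lemma 3, §2.2. [`Seis2022`]
* R. J. DiPerna, P.-L. Lions, Invent. Math. 98 (1989), §II.1. [`DiPernaLions1989`]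
-/

noncomputable section

open MeasureTheory TopologicalSpace Set Function Filter Topology Metric ContinuousLinearMap
open scoped ENNReal NNReal Convolution ContDiff InnerProductSpace

namespace Literature.Analysis.FluidPDE

namespace Torus

variable {d : Type*} [Fintype d]

/-! ## Evenness of the Laplacian of the kernel -/

/-- The Laplacian of the (even) torus kernel is even: `Δk(-z) = Δk(z)`. [folklore] -/
theorem laplacian_kernel_neg {ε : ℝ} (hε : 0 < ε) (hε' : ε ≤ 1 / 4) (z : UnitAddTorus d) :
    FunctionSpaces.Torus.laplacian (FunctionSpaces.Torus.kernel ε) (-z) =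
      FunctionSpaces.Torus.laplacian (FunctionSpaces.Torus.kernel ε) z := by
  have hk := FunctionSpaces.Torus.isSmooth_kernel (d := d) hε hε'
  have hfun : (fun w : UnitAddTorus d => FunctionSpaces.Torus.kernel ε (0 - w)) = FunctionSpaces.Torus.kernel ε := by
    funext w
    rw [zero_sub, FunctionSpaces.Torus.kernel_neg hε hε']
  have h := FunctionSpaces.Torus.laplacian_comp_sub_left hk 0 z
  rw [hfun, zero_sub] at h
  exact h.symm

/-- `Δk(x - y) = Δk(y - x)` for the torus kernel. [folklore] -/
theorem laplacian_kernel_sub_comm {ε : ℝ} (hε : 0 < ε) (hε' : ε ≤ 1 / 4) (x y : UnitAddTorus d) :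
    FunctionSpaces.Torus.laplacian (FunctionSpaces.Torus.kernel ε) (x - y) =
      FunctionSpaces.Torus.laplacian (FunctionSpaces.Torus.kernel ε) (y - x) := by
  rw [← neg_sub, laplacian_kernel_neg hε hε']

/-! ## Slice identities against a Lipschitz weight -/

section Slice

variable {δ ζ : UnitAddTorus d → ℝ} {v : UnitAddTorus d → EuclideanSpace ℝ d} {ε : ℝ} {K : ℝ≥0}

/-- A Lipschitz function on the compact torus is bounded and continuous; we record a bound. [folklore] -/
theorem exists_abs_le_of_lipschitz (hζ : LipschitzWith K ζ) : ∃ C, ∀ x, |ζ x| ≤ C := by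
  obtain ⟨C, hC⟩ := FunctionSpaces.Torus.exists_forall_norm_le_of_continuous hζ.continuous
  exact ⟨C, fun x => by simpa [Real.norm_eq_abs] using hC x⟩

/-- **The transport part, step 1**: `∫ ζ(x) ∫ δ(y)⟪v(y), ∇k(x-y)⟫ dy dx = -∫ δ(y) ⟪v(y), ∇(ζ ⋆ k)(y)⟫ dy`
for `δ, ‖v‖δ ∈ L¹`, bounded continuous `ζ` (Fubini; `∇k` is odd). The tree's
`integral_conv_mul_transport_eq` is the case `ζ = δ ⋆ k`, `v` bounded. [folklore] -/
theorem integral_mul_transport_eq (hδ : Integrable δ volume) (hv : AEStronglyMeasurable v volume)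
    (hvδ : Integrable (fun y => ‖v y‖ * δ y) volume) (hζc : Continuous ζ) (hε : 0 < ε) (hε' : ε ≤ 1 / 4) :
    ∫ x, ζ x * ∫ y, δ y * ⟪v y, FunctionSpaces.Torus.gradient (FunctionSpaces.Torus.kernel ε) (x - y)⟫_ℝ =
      -∫ y, δ y * ⟪v y, FunctionSpaces.Torus.gradient (ζ ⋆ FunctionSpaces.Torus.kernel ε) y⟫_ℝ := by
  set k : UnitAddTorus d → ℝ := FunctionSpaces.Torus.kernel ε with hk_def
  have hk : FunctionSpaces.Torus.IsSmooth k := FunctionSpaces.Torus.isSmooth_kernel hε hε'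
  have hζi : Integrable ζ volume := hζc.integrable_unitAddTorus
  obtain ⟨Cζ, hCζ⟩ := FunctionSpaces.Torus.exists_forall_norm_le_of_continuous hζc
  obtain ⟨Ck, hCk⟩ := FunctionSpaces.Torus.exists_forall_norm_le_of_continuous hk.gradient.continuous
  set F : UnitAddTorus d → UnitAddTorus d → ℝ := fun x y =>
    ζ x * (δ y * ⟪v y, FunctionSpaces.Torus.gradient k (x - y)⟫_ℝ) with hF_def
  have hgc : Continuous fun p : UnitAddTorus d × UnitAddTorus d => FunctionSpaces.Torus.gradient k (p.1 - p.2) :=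
    hk.gradient.continuous.comp (continuous_fst.sub continuous_snd)
  have hFm : AEStronglyMeasurable (uncurry F) ((volume : Measure (UnitAddTorus d)).prod volume) :=
    ((hζc.comp continuous_fst).aestronglyMeasurable).mul
      ((hδ.aestronglyMeasurable.comp_snd).mul ((hv.comp_snd).inner hgc.aestronglyMeasurable))
  have hFi : Integrable (uncurry F) ((volume : Measure (UnitAddTorus d)).prod volume) := by
    refine Integrable.mono' (g := fun p : UnitAddTorus d × UnitAddTorus d => Cζ * Ck * ‖‖v p.2‖ * δ p.2‖)
      ((integrable_const (Cζ * Ck)).mul_prod hvδ.norm) hFm ?_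
    refine Eventually.of_forall fun p => ?_
    simp only [uncurry, hF_def, norm_mul, Real.norm_eq_abs, abs_norm]
    have h1 : |⟪v p.2, FunctionSpaces.Torus.gradient k (p.1 - p.2)⟫_ℝ| ≤ ‖v p.2‖ * Ck :=
      (abs_real_inner_le_norm _ _).trans (mul_le_mul_of_nonneg_left (hCk _) (norm_nonneg _))
    have h2 : |ζ p.1| ≤ Cζ := by simpa [Real.norm_eq_abs] using hCζ p.1
    have hCζ0 : 0 ≤ Cζ := (abs_nonneg _).trans h2
    calc |ζ p.1| * (|δ p.2| * |⟪v p.2, FunctionSpaces.Torus.gradient k (p.1 - p.2)⟫_ℝ|)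
        ≤ Cζ * (|δ p.2| * (‖v p.2‖ * Ck)) := by gcongr
      _ = Cζ * Ck * (‖v p.2‖ * |δ p.2|) := by ring
  -- swap the integrals
  have hswap := integral_integral_swap hFi
  have hlhs : ∫ x, ζ x * ∫ y, δ y * ⟪v y, FunctionSpaces.Torus.gradient k (x - y)⟫_ℝ = ∫ x, ∫ y, F x y := by
    refine integral_congr_ae (Eventually.of_forall fun x => ?_)
    simp only [hF_def]
    exact (MeasureTheory.integral_const_mul _ _).symm
  rw [hlhs, hswap]
  -- the inner `x`-integral: `∫ ζ(x) ∇k(x - y) dx = -∇(ζ ⋆ k)(y)`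
  have hinner : ∀ y, ∫ x, F x y = -(δ y * ⟪v y, FunctionSpaces.Torus.gradient (ζ ⋆ k) y⟫_ℝ) := by
    intro y
    have hint : Integrable (fun x => ζ x • FunctionSpaces.Torus.gradient k (y - x)) volume :=
      FunctionSpaces.Torus.integrable_smul_comp_sub hζi hk.gradient.continuous y
    have e1 : ∀ x, F x y = -(δ y * ⟪v y, ζ x • FunctionSpaces.Torus.gradient k (y - x)⟫_ℝ) := fun x => by
      simp only [hF_def]
      rw [gradient_kernel_sub_comm hε hε' x y, inner_neg_right, real_inner_smul_right]
      ring
    simp_rw [e1]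
    rw [integral_neg, MeasureTheory.integral_const_mul, integral_inner hint,
      FunctionSpaces.Torus.gradient_convolution hζi hk y, convolution_lsmul]
  simp_rw [hinner]
  rw [integral_neg]

/-- **The transport part, step 2 (momentum form)**: for `K`-Lipschitz `ζ`,
`∫ δ(y) ⟪v(y), ∇(ζ ⋆ k)(y)⟫ dy = ∫ ⟪V(x), ∇ζ(x)⟫ dx` with `V(x) = ∫ δ(y) k(x-y) v(y) dy`
(`∇(ζ ⋆ k) = k ⋆ ∇ζ` for Lipschitz `ζ`, Fubini, evenness of `k`). [folklore] -/
theorem integral_mul_inner_gradient_convolution_eq (hδ : Integrable δ volume) (hv : AEStronglyMeasurable v volume)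
    (hvδ : Integrable (fun y => ‖v y‖ * δ y) volume) (hζ : LipschitzWith K ζ) (hε : 0 < ε) (hε' : ε ≤ 1 / 4) :
    ∫ y, δ y * ⟪v y, FunctionSpaces.Torus.gradient (ζ ⋆ FunctionSpaces.Torus.kernel ε) y⟫_ℝ =
      ∫ x, ⟪∫ y, (δ y * FunctionSpaces.Torus.kernel ε (x - y)) • v y, FunctionSpaces.Torus.gradient ζ x⟫_ℝ := by
  set k : UnitAddTorus d → ℝ := FunctionSpaces.Torus.kernel ε with hk_def
  have hk : FunctionSpaces.Torus.IsSmooth k := FunctionSpaces.Torus.isSmooth_kernel hε hε'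
  obtain ⟨Ck, hCk⟩ := FunctionSpaces.Torus.exists_forall_norm_le_of_continuous hk.continuous
  have hgb : ∀ x, ‖FunctionSpaces.Torus.gradient ζ x‖ ≤ K := FunctionSpaces.Torus.norm_gradient_le_of_lipschitz hζ
  have hgm : Measurable (FunctionSpaces.Torus.gradient ζ) := FunctionSpaces.Torus.measurable_gradient ζ
  -- the joint integrand
  set F : UnitAddTorus d → UnitAddTorus d → ℝ := fun y x =>
    δ y * k (y - x) * ⟪v y, FunctionSpaces.Torus.gradient ζ x⟫_ℝ with hF_def
  have hkc : Continuous fun p : UnitAddTorus d × UnitAddTorus d => k (p.1 - p.2) :=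
    hk.continuous.comp (continuous_fst.sub continuous_snd)
  have hFm : AEStronglyMeasurable (uncurry F) ((volume : Measure (UnitAddTorus d)).prod volume) :=
    ((hδ.aestronglyMeasurable.comp_fst).mul hkc.aestronglyMeasurable).mul
      ((hv.comp_fst).inner (hgm.comp measurable_snd).aestronglyMeasurable)
  have hFi : Integrable (uncurry F) ((volume : Measure (UnitAddTorus d)).prod volume) := by
    refine Integrable.mono' (g := fun p : UnitAddTorus d × UnitAddTorus d => ‖‖v p.1‖ * δ p.1‖ * (Ck * K))
      (hvδ.norm.mul_prod (integrable_const (Ck * K))) hFm ?_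
    refine Eventually.of_forall fun p => ?_
    simp only [uncurry, hF_def, norm_mul, Real.norm_eq_abs, abs_norm]
    have h1 : |⟪v p.1, FunctionSpaces.Torus.gradient ζ p.2⟫_ℝ| ≤ ‖v p.1‖ * K :=
      (abs_real_inner_le_norm _ _).trans (mul_le_mul_of_nonneg_left (hgb _) (norm_nonneg _))
    have h2 : |k (p.1 - p.2)| ≤ Ck := by simpa [Real.norm_eq_abs] using hCk (p.1 - p.2)
    have hCk0 : 0 ≤ Ck := (norm_nonneg _).trans (hCk 0)
    calc |δ p.1| * |k (p.1 - p.2)| * |⟪v p.1, FunctionSpaces.Torus.gradient ζ p.2⟫_ℝ|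
        ≤ |δ p.1| * Ck * (‖v p.1‖ * K) :=
          mul_le_mul (mul_le_mul_of_nonneg_left h2 (abs_nonneg _)) h1 (abs_nonneg _) (mul_nonneg (abs_nonneg _) hCk0)
      _ = ‖v p.1‖ * |δ p.1| * (Ck * K) := by ring
  -- left-hand side as `∫ y, ∫ x, F y x`
  have hlhs : ∫ y, δ y * ⟪v y, FunctionSpaces.Torus.gradient (ζ ⋆ k) y⟫_ℝ = ∫ y, ∫ x, F y x := by
    refine integral_congr_ae (Eventually.of_forall fun y => ?_)
    dsimp only
    have hint : Integrable (fun x => k (y - x) • FunctionSpaces.Torus.gradient ζ x) volume :=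
      Integrable.mono' (integrable_const (Ck * K))
        ((hk.continuous.comp (continuous_const.sub continuous_id)).aestronglyMeasurable.smul hgm.aestronglyMeasurable)
        (Eventually.of_forall fun x => by
          rw [norm_smul]
          exact mul_le_mul (hCk _) (hgb _) (norm_nonneg _) ((norm_nonneg _).trans (hCk 0)))
    rw [FunctionSpaces.Torus.gradient_convolution_of_lipschitz hζ hk y, ← integral_inner hint,
      ← MeasureTheory.integral_const_mul]
    refine integral_congr_ae (Eventually.of_forall fun x => ?_)
    simp only [hF_def, real_inner_smul_right]
    ring
  -- right-hand side as `∫ x, ∫ y, F y x`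
  have hrhs : ∫ x, ⟪∫ y, (δ y * k (x - y)) • v y, FunctionSpaces.Torus.gradient ζ x⟫_ℝ = ∫ x, ∫ y, F y x := by
    refine integral_congr_ae (Eventually.of_forall fun x => ?_)
    dsimp only
    have hint : Integrable (fun y => (δ y * k (x - y)) • v y) volume := by
      refine Integrable.mono' (hvδ.norm.mul_const Ck)
        ((hδ.aestronglyMeasurable.mul (hk.continuous.comp (continuous_const.sub continuous_id)).aestronglyMeasurable).smul hv)
        (Eventually.of_forall fun y => ?_)
      rw [norm_smul, norm_mul, Real.norm_eq_abs, Real.norm_eq_abs, Real.norm_eq_abs, abs_mul, abs_norm]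
      have h2 : |k (x - y)| ≤ Ck := by simpa [Real.norm_eq_abs] using hCk (x - y)
      calc |δ y| * |k (x - y)| * ‖v y‖ ≤ |δ y| * Ck * ‖v y‖ := by gcongr
        _ = ‖v y‖ * |δ y| * Ck := by ring
    rw [real_inner_comm, ← integral_inner hint]
    refine integral_congr_ae (Eventually.of_forall fun y => ?_)
    simp only [hF_def, real_inner_smul_right, real_inner_comm (v y)]
    rw [hk_def, FunctionSpaces.Torus.kernel_sub_comm hε hε' x y]
  rw [hlhs, hrhs]
  exact integral_integral_swap hFi

/-- **The transport part in momentum form**: for `δ, ‖v‖δ ∈ L¹` and `K`-Lipschitz `ζ`,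
`∫ ζ(x) ∫ δ(y)⟪v(y), ∇k(x-y)⟫ dy dx = -∫ ⟪V(x), ∇ζ(x)⟫ dx`, `V(x) = ∫ δ(y) k(x-y) v(y) dy`. [folklore] -/
theorem integral_mul_transport_eq_neg_integral_inner (hδ : Integrable δ volume) (hv : AEStronglyMeasurable v volume)
    (hvδ : Integrable (fun y => ‖v y‖ * δ y) volume) (hζ : LipschitzWith K ζ) (hε : 0 < ε) (hε' : ε ≤ 1 / 4) :
    ∫ x, ζ x * ∫ y, δ y * ⟪v y, FunctionSpaces.Torus.gradient (FunctionSpaces.Torus.kernel ε) (x - y)⟫_ℝ =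
      -∫ x, ⟪∫ y, (δ y * FunctionSpaces.Torus.kernel ε (x - y)) • v y, FunctionSpaces.Torus.gradient ζ x⟫_ℝ := by
  rw [integral_mul_transport_eq hδ hv hvδ hζ.continuous hε hε',
    integral_mul_inner_gradient_convolution_eq hδ hv hvδ hζ hε hε']

/-- **The diffusion part**: `∫ ζ(x) ∫ δ(y) Δk(x-y) dy dx = ∫ δ(y) Δ(ζ ⋆ k)(y) dy` for `δ ∈ L¹` and
continuous `ζ` (Fubini; `Δk` is even, `Δ(ζ ⋆ k) = ζ ⋆ Δk`). [folklore] -/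
theorem integral_mul_diffusion_eq (hδ : Integrable δ volume) (hζc : Continuous ζ) (hε : 0 < ε) (hε' : ε ≤ 1 / 4) :
    ∫ x, ζ x * ∫ y, δ y * FunctionSpaces.Torus.laplacian (FunctionSpaces.Torus.kernel ε) (x - y) =
      ∫ y, δ y * FunctionSpaces.Torus.laplacian (ζ ⋆ FunctionSpaces.Torus.kernel ε) y := by
  set k : UnitAddTorus d → ℝ := FunctionSpaces.Torus.kernel ε with hk_def
  have hk : FunctionSpaces.Torus.IsSmooth k := FunctionSpaces.Torus.isSmooth_kernel hε hε'
  have hζi : Integrable ζ volume := hζc.integrable_unitAddTorus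
  obtain ⟨Cζ, hCζ⟩ := FunctionSpaces.Torus.exists_forall_norm_le_of_continuous hζc
  obtain ⟨Cl, hCl⟩ := FunctionSpaces.Torus.exists_forall_norm_le_of_continuous hk.laplacian.continuous
  set F : UnitAddTorus d → UnitAddTorus d → ℝ := fun x y => ζ x * (δ y * FunctionSpaces.Torus.laplacian k (x - y)) with hF_def
  have hlc : Continuous fun p : UnitAddTorus d × UnitAddTorus d => FunctionSpaces.Torus.laplacian k (p.1 - p.2) :=
    hk.laplacian.continuous.comp (continuous_fst.sub continuous_snd)
  have hFm : AEStronglyMeasurable (uncurry F) ((volume : Measure (UnitAddTorus d)).prod volume) :=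
    ((hζc.comp continuous_fst).aestronglyMeasurable).mul ((hδ.aestronglyMeasurable.comp_snd).mul hlc.aestronglyMeasurable)
  have hFi : Integrable (uncurry F) ((volume : Measure (UnitAddTorus d)).prod volume) := by
    refine Integrable.mono' (g := fun p : UnitAddTorus d × UnitAddTorus d => Cζ * Cl * ‖δ p.2‖)
      ((integrable_const (Cζ * Cl)).mul_prod hδ.norm) hFm ?_
    refine Eventually.of_forall fun p => ?_
    simp only [uncurry, hF_def, norm_mul, Real.norm_eq_abs]
    have h2 : |ζ p.1| ≤ Cζ := by simpa [Real.norm_eq_abs] using hCζ p.1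
    have h3 : |FunctionSpaces.Torus.laplacian k (p.1 - p.2)| ≤ Cl := by simpa [Real.norm_eq_abs] using hCl (p.1 - p.2)
    have hCζ0 : 0 ≤ Cζ := (abs_nonneg _).trans h2
    calc |ζ p.1| * (|δ p.2| * |FunctionSpaces.Torus.laplacian k (p.1 - p.2)|) ≤ Cζ * (|δ p.2| * Cl) := by gcongr
      _ = Cζ * Cl * |δ p.2| := by ring
  have hlhs : ∫ x, ζ x * ∫ y, δ y * FunctionSpaces.Torus.laplacian k (x - y) = ∫ x, ∫ y, F x y := by
    refine integral_congr_ae (Eventually.of_forall fun x => ?_)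
    simp only [hF_def]
    exact (MeasureTheory.integral_const_mul _ _).symm
  rw [hlhs, integral_integral_swap hFi]
  refine integral_congr_ae (Eventually.of_forall fun y => ?_)
  have e1 : ∀ x, F x y = δ y * (ζ x * FunctionSpaces.Torus.laplacian k (y - x)) := fun x => by
    simp only [hF_def]
    rw [laplacian_kernel_sub_comm hε hε' x y]
    ring
  simp_rw [e1]
  rw [MeasureTheory.integral_const_mul, FunctionSpaces.Torus.laplacian_convolution hζi hk y, convolution_lsmul]
  simp only [smul_eq_mul]

/-- **The flux paired with a Lipschitz weight**: with `G(x) = ∫ δ(y)(-⟪v y, ∇k(x-y)⟫ + κ Δk(x-y)) dy`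
and `V(x) = ∫ δ(y) k(x-y) v(y) dy`,
`∫ ζ G = ∫ ⟪V, ∇ζ⟫ + κ ∫ δ Δ(ζ ⋆ k)` (the weak formulation tested with `ζ ⋆ k`, transport term in
momentum form). [folklore] -/
theorem integral_mul_flux_eq (hδ : Integrable δ volume) (hv : AEStronglyMeasurable v volume)
    (hvδ : Integrable (fun y => ‖v y‖ * δ y) volume) (hζ : LipschitzWith K ζ) (hε : 0 < ε) (hε' : ε ≤ 1 / 4) (κ : ℝ) :
    ∫ x, ζ x * ∫ y, δ y * (-⟪v y, FunctionSpaces.Torus.gradient (FunctionSpaces.Torus.kernel ε) (x - y)⟫_ℝ +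
        κ * FunctionSpaces.Torus.laplacian (FunctionSpaces.Torus.kernel ε) (x - y)) =
      (∫ x, ⟪∫ y, (δ y * FunctionSpaces.Torus.kernel ε (x - y)) • v y, FunctionSpaces.Torus.gradient ζ x⟫_ℝ) +
        κ * ∫ y, δ y * FunctionSpaces.Torus.laplacian (ζ ⋆ FunctionSpaces.Torus.kernel ε) y := by
  set k : UnitAddTorus d → ℝ := FunctionSpaces.Torus.kernel ε with hk_def
  have hk : FunctionSpaces.Torus.IsSmooth k := FunctionSpaces.Torus.isSmooth_kernel hε hε'
  obtain ⟨Ck, hCk⟩ := FunctionSpaces.Torus.exists_forall_norm_le_of_continuous hk.gradient.continuous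
  obtain ⟨Cl, hCl⟩ := FunctionSpaces.Torus.exists_forall_norm_le_of_continuous hk.laplacian.continuous
  -- pointwise splitting of `G`
  have hsplit : ∀ x, ∫ y, δ y * (-⟪v y, FunctionSpaces.Torus.gradient k (x - y)⟫_ℝ + κ * FunctionSpaces.Torus.laplacian k (x - y)) =
      -(∫ y, δ y * ⟪v y, FunctionSpaces.Torus.gradient k (x - y)⟫_ℝ) + κ * ∫ y, δ y * FunctionSpaces.Torus.laplacian k (x - y) := by
    intro x
    have hgc : Continuous fun y => FunctionSpaces.Torus.gradient k (x - y) :=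
      hk.gradient.continuous.comp (continuous_const.sub continuous_id)
    have i1 : Integrable (fun y => δ y * ⟪v y, FunctionSpaces.Torus.gradient k (x - y)⟫_ℝ) volume := by
      refine Integrable.mono' (hvδ.norm.const_mul Ck)
        (hδ.aestronglyMeasurable.mul (hv.inner hgc.aestronglyMeasurable)) (Eventually.of_forall fun y => ?_)
      simp only [Real.norm_eq_abs, abs_mul, abs_norm]
      calc |δ y| * |⟪v y, FunctionSpaces.Torus.gradient k (x - y)⟫_ℝ|
          ≤ |δ y| * (‖v y‖ * Ck) := mul_le_mul_of_nonneg_left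
            ((abs_real_inner_le_norm _ _).trans (mul_le_mul_of_nonneg_left (hCk _) (norm_nonneg _))) (abs_nonneg _)
        _ = Ck * (‖v y‖ * |δ y|) := by ring
    have i2 : Integrable (fun y => δ y * FunctionSpaces.Torus.laplacian k (x - y)) volume :=
      hδ.mul_bdd (c := Cl) (hk.laplacian.continuous.comp (continuous_const.sub continuous_id)).aestronglyMeasurable
        (Eventually.of_forall fun y => hCl _)
    rw [← integral_neg, ← MeasureTheory.integral_const_mul, ← integral_add i1.fun_neg (i2.const_mul κ)]
    refine integral_congr_ae (Eventually.of_forall fun y => ?_)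
    ring
  simp_rw [hsplit]
  -- the two pieces are continuous in `x` (flux integrals), hence integrable against `ζ`
  have hI1c : Continuous fun x => ∫ y, δ y * ⟪v y, FunctionSpaces.Torus.gradient k (x - y)⟫_ℝ := by
    have h0 := continuous_fluxIntegral hδ hv hvδ hk 0
    have e : (fun x => ∫ y, δ y * ⟪v y, FunctionSpaces.Torus.gradient k (x - y)⟫_ℝ) =
        fun x => -∫ y, δ y * (-⟪v y, FunctionSpaces.Torus.gradient k (x - y)⟫_ℝ + 0 * FunctionSpaces.Torus.laplacian k (x - y)) := by
      funext x
      rw [← integral_neg]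
      refine integral_congr_ae (Eventually.of_forall fun y => ?_)
      ring
    rw [e]
    exact h0.neg
  have hI2c : Continuous fun x => ∫ y, δ y * FunctionSpaces.Torus.laplacian k (x - y) := by
    have e : (fun x => ∫ y, δ y * FunctionSpaces.Torus.laplacian k (x - y)) = fun x => (δ ⋆ FunctionSpaces.Torus.laplacian k) x := by
      funext x; simp only [convolution_lsmul, smul_eq_mul]
    rw [e]
    exact FunctionSpaces.Torus.continuous_convolution hδ hk.laplacian.continuous
  have j1 : Integrable (fun x => ζ x * ∫ y, δ y * ⟪v y, FunctionSpaces.Torus.gradient k (x - y)⟫_ℝ) volume :=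
    (hζ.continuous.mul hI1c).integrable_unitAddTorus
  have j2 : Integrable (fun x => ζ x * (κ * ∫ y, δ y * FunctionSpaces.Torus.laplacian k (x - y))) volume :=
    (hζ.continuous.mul (continuous_const.mul hI2c)).integrable_unitAddTorus
  have e : ∀ x, ζ x * (-(∫ y, δ y * ⟪v y, FunctionSpaces.Torus.gradient k (x - y)⟫_ℝ) + κ * ∫ y, δ y * FunctionSpaces.Torus.laplacian k (x - y)) =
      -(ζ x * ∫ y, δ y * ⟪v y, FunctionSpaces.Torus.gradient k (x - y)⟫_ℝ) + ζ x * (κ * ∫ y, δ y * FunctionSpaces.Torus.laplacian k (x - y)) :=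
    fun x => by ring
  simp_rw [e]
  rw [integral_add j1.fun_neg j2, integral_neg, integral_mul_transport_eq_neg_integral_inner hδ hv hvδ hζ hε hε', neg_neg]
  congr 1
  have e2 : ∫ x, ζ x * (κ * ∫ y, δ y * FunctionSpaces.Torus.laplacian k (x - y)) =
      κ * ∫ x, ζ x * ∫ y, δ y * FunctionSpaces.Torus.laplacian k (x - y) := by
    rw [← MeasureTheory.integral_const_mul]
    exact integral_congr_ae (Eventually.of_forall fun x => by ring)
  rw [e2, integral_mul_diffusion_eq hδ hζ.continuous hε hε']

end Slice

/-! ## The everywhere-in-time representative of the mollified solution -/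

namespace IsWeakScalarTransportOn

variable {T κ : ℝ} {u : ℝ → UnitAddTorus d → EuclideanSpace ℝ d} {θ₀ : UnitAddTorus d → ℝ}
  {θ : ℝ → UnitAddTorus d → ℝ}

/-- **Integrability of `w(x) G(s,x)` on `(0,T) × T^d`** for a bounded measurable weight `w`. [folklore] -/
theorem integrable_weight_mul_flux (h : IsWeakScalarTransportOn T κ u θ₀ θ) {k : UnitAddTorus d → ℝ}
    (hk : FunctionSpaces.Torus.IsSmooth k) {w : UnitAddTorus d → ℝ} (hw : AEStronglyMeasurable w volume)
    {Cw : ℝ} (hCw : ∀ x, |w x| ≤ Cw) :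
    Integrable (fun p : ℝ × UnitAddTorus d => w p.2 *
      ∫ y, θ p.1 y * (-⟪u p.1 y, FunctionSpaces.Torus.gradient k (p.2 - y)⟫_ℝ + κ * FunctionSpaces.Torus.laplacian k (p.2 - y)))
      (((volume : Measure ℝ).restrict (Ioo 0 T)).prod volume) := by
  set μT : Measure ℝ := (volume : Measure ℝ).restrict (Ioo 0 T) with hμT
  obtain ⟨bound, hbi, hGb⟩ := h.exists_flux_bound₁ hk
  have hCw0 : 0 ≤ Cw := (abs_nonneg _).trans (hCw 0)
  have hFm : AEStronglyMeasurable (fun p : ℝ × UnitAddTorus d => w p.2 *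
      ∫ y, θ p.1 y * (-⟪u p.1 y, FunctionSpaces.Torus.gradient k (p.2 - y)⟫_ℝ + κ * FunctionSpaces.Torus.laplacian k (p.2 - y)))
      (μT.prod volume) :=
    (hw.comp_snd).mul (h.aestronglyMeasurable_uncurry_flux₁ hk)
  have hBi : Integrable (fun p : ℝ × UnitAddTorus d => Cw * bound p.1 * (1 : ℝ)) (μT.prod volume) :=
    ((hbi.const_mul Cw).mul_prod (integrable_const (1 : ℝ)))
  refine Integrable.mono' (hBi.congr (Eventually.of_forall fun p => mul_one _)) hFm ?_
  have hae : ∀ᵐ s ∂μT, ∀ x, ‖w x *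
      ∫ y, θ s y * (-⟪u s y, FunctionSpaces.Torus.gradient k (x - y)⟫_ℝ + κ * FunctionSpaces.Torus.laplacian k (x - y))‖ ≤
        Cw * bound s := by
    filter_upwards [hGb] with s hG x
    rw [norm_mul, Real.norm_eq_abs]
    exact mul_le_mul (hCw _) (hG x) (norm_nonneg _) hCw0
  have := (Measure.quasiMeasurePreserving_fst (μ := μT) (ν := (volume : Measure (UnitAddTorus d)))).ae hae
  filter_upwards [this] with p hp
  exact hp p.2

/-- **The everywhere-in-time representative** of the mollified solution:
`Ã(t, x) = ∫ θ₀(y) k(x-y) dy + ∫_{(0,t]} G(s,x) ds`. [folklore] -/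
def molRep (κ : ℝ) (u : ℝ → UnitAddTorus d → EuclideanSpace ℝ d) (θ₀ : UnitAddTorus d → ℝ)
    (θ : ℝ → UnitAddTorus d → ℝ) (k : UnitAddTorus d → ℝ) (t : ℝ) (x : UnitAddTorus d) : ℝ :=
  (∫ y, θ₀ y * k (x - y)) + ∫ s in Ioc 0 t, ∫ y, θ s y *
    (-⟪u s y, FunctionSpaces.Torus.gradient k (x - y)⟫_ℝ + κ * FunctionSpaces.Torus.laplacian k (x - y))

/-- For a.e. `t ∈ (0,T)` the representative is the mollified solution: `Ã(t,x) = (θ(t) ⋆ k)(x)`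
for all `x`. [folklore] -/
theorem ae_molRep_eq (h : IsWeakScalarTransportOn T κ u θ₀ θ) (hθ₀ : Integrable θ₀ volume)
    {k : UnitAddTorus d → ℝ} (hk : FunctionSpaces.Torus.IsSmooth k) :
    ∀ᵐ t ∂(volume.restrict (Ioo 0 T)), ∀ x, molRep κ u θ₀ θ k t x = (θ t ⋆ k) x := by
  filter_upwards [h.ae_forall_molInt_eq_datum_add_setIntegral_flux hθ₀ hk] with t ht x
  rw [molRep, ← ht x]
  simp only [convolution_lsmul, smul_eq_mul]

/-- **The time-increment formula**: for `0 ≤ t' ≤ t < T` and a bounded measurable weight `w`,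
`∫ w Ã(t) - ∫ w Ã(t') = ∫_{(t',t]} ∫ w(x) G(s,x) dx ds`; both `x`-integrals exist
(`Ã(t,·)` is a continuous mollification plus an integrable strip integral) and the right-hand
side is an honest Fubini. [folklore] -/
theorem integral_mul_molRep_sub (h : IsWeakScalarTransportOn T κ u θ₀ θ) (hθ₀ : Integrable θ₀ volume)
    {k : UnitAddTorus d → ℝ} (hk : FunctionSpaces.Torus.IsSmooth k) {w : UnitAddTorus d → ℝ}
    (hw : AEStronglyMeasurable w volume) {Cw : ℝ} (hCw : ∀ x, |w x| ≤ Cw) {t' t : ℝ} (ht' : 0 ≤ t')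
    (htt : t' ≤ t) (ht : t < T) :
    (∫ x, w x * molRep κ u θ₀ θ k t x) - ∫ x, w x * molRep κ u θ₀ θ k t' x =
      ∫ s in Ioc t' t, ∫ x, w x *
        ∫ y, θ s y * (-⟪u s y, FunctionSpaces.Torus.gradient k (x - y)⟫_ℝ + κ * FunctionSpaces.Torus.laplacian k (x - y)) := by
  set Gf : ℝ → UnitAddTorus d → ℝ := fun s x => ∫ y, θ s y *
    (-⟪u s y, FunctionSpaces.Torus.gradient k (x - y)⟫_ℝ + κ * FunctionSpaces.Torus.laplacian k (x - y)) with hGf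
  -- integrability of `s ↦ G(s,x)` on `(0,T)` for each `x`, and of `w G` on the strips
  have hGx : ∀ x, IntegrableOn (fun s => Gf s x) (Ioo 0 T) volume := fun x =>
    (h.integrable_mul_flux hk x).integral_prod_left
  have hsub : Ioc t' t ⊆ Ioo 0 T := fun s hs => ⟨ht'.trans_lt hs.1, hs.2.trans_lt ht⟩
  have hsub0' : Ioc 0 t' ⊆ Ioo 0 T := Ioc_subset_Ioo_right (htt.trans_lt ht)
  -- pointwise: `Ã(t,x) - Ã(t',x) = ∫_{(t',t]} G(s,x) ds`
  have hpt : ∀ x, molRep κ u θ₀ θ k t x - molRep κ u θ₀ θ k t' x = ∫ s in Ioc t' t, Gf s x := by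
    intro x
    simp only [molRep]
    rw [add_sub_add_left_eq_sub, ← Ioc_union_Ioc_eq_Ioc ht' htt,
      setIntegral_union (Ioc_disjoint_Ioc_of_le le_rfl) measurableSet_Ioc ((hGx x).mono_set hsub0')
        ((hGx x).mono_set hsub)]
    ring
  -- the strip integrals of `w G`
  have hle : (volume : Measure ℝ).restrict (Ioc t' t) ≤ (volume : Measure ℝ).restrict (Ioo 0 T) :=
    Measure.restrict_mono_set _ hsub
  have hFi := (h.integrable_weight_mul_flux hk hw hCw).mono_measure (Measure.prod_mono hle le_rfl)
  -- integrability in `x` of `w Ã(a)` (so that we may subtract)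
  have hA0c : Continuous fun x => ∫ y, θ₀ y * k (x - y) := by
    have e : (fun x => ∫ y, θ₀ y * k (x - y)) = θ₀ ⋆ k := by
      funext x; simp only [convolution_lsmul, smul_eq_mul]
    rw [e]; exact FunctionSpaces.Torus.continuous_convolution hθ₀ hk.continuous
  have hwi : ∀ {f : UnitAddTorus d → ℝ}, Integrable f volume → Integrable (fun x => w x * f x) volume := by
    intro f hf
    exact hf.bdd_mul hw (Eventually.of_forall fun x => by rw [Real.norm_eq_abs]; exact hCw x)
  have hstrip : ∀ {a : ℝ}, a < T → Integrable (fun x => ∫ s in Ioc 0 a, Gf s x) volume := by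
    intro a haT
    have hle' : (volume : Measure ℝ).restrict (Ioc 0 a) ≤ (volume : Measure ℝ).restrict (Ioo 0 T) :=
      Measure.restrict_mono_set _ (Ioc_subset_Ioo_right haT)
    have h1 := (h.integrable_weight_mul_flux hk (aestronglyMeasurable_const (b := (1 : ℝ))) (Cw := 1)
      (fun x => by simp)).mono_measure (Measure.prod_mono hle' le_rfl)
    simpa using h1.swap.integral_prod_left
  have hrep : ∀ {a : ℝ}, a < T → Integrable (fun x => w x * molRep κ u θ₀ θ k a x) volume := by
    intro a haT
    exact hwi (hA0c.integrable_unitAddTorus.add (hstrip haT))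
  rw [← integral_sub (hrep ht) (hrep (htt.trans_lt ht))]
  have e : ∀ x, w x * molRep κ u θ₀ θ k t x - w x * molRep κ u θ₀ θ k t' x = ∫ s in Ioc t' t, w x * Gf s x := by
    intro x
    rw [← mul_sub, hpt x, ← MeasureTheory.integral_const_mul]
  simp_rw [e]
  exact integral_integral_swap (μ := (volume : Measure (UnitAddTorus d)))
    (ν := (volume : Measure ℝ).restrict (Ioc t' t)) (f := fun x s => w x * Gf s x) hFi.swap

/-- **Uniform absolute continuity in time of `∫ w Ã(t)`**: with the flux majorant `bound` of
`exists_flux_bound₁`, `|∫ w Ã(t) - ∫ w Ã(t')| ≤ C_w ∫_{(t',t]} bound` for `0 ≤ t' ≤ t < T` and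
every weight `|w| ≤ C_w`. [folklore] -/
theorem abs_integral_mul_molRep_sub_le (h : IsWeakScalarTransportOn T κ u θ₀ θ) (hθ₀ : Integrable θ₀ volume)
    {k : UnitAddTorus d → ℝ} (hk : FunctionSpaces.Torus.IsSmooth k) {bound : ℝ → ℝ}
    (hbi : IntegrableOn bound (Ioo 0 T) volume)
    (hGb : ∀ᵐ s ∂(volume.restrict (Ioo 0 T)), ∀ x,
      ‖∫ y, θ s y * (-⟪u s y, FunctionSpaces.Torus.gradient k (x - y)⟫_ℝ + κ * FunctionSpaces.Torus.laplacian k (x - y))‖ ≤ bound s)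
    {w : UnitAddTorus d → ℝ} (hw : AEStronglyMeasurable w volume) {Cw : ℝ} (hCw : ∀ x, |w x| ≤ Cw)
    {t' t : ℝ} (ht' : 0 ≤ t') (htt : t' ≤ t) (ht : t < T) :
    |(∫ x, w x * molRep κ u θ₀ θ k t x) - ∫ x, w x * molRep κ u θ₀ θ k t' x| ≤ Cw * ∫ s in Ioc t' t, bound s := by
  have hCw0 : 0 ≤ Cw := (abs_nonneg _).trans (hCw 0)
  have hsub : Ioc t' t ⊆ Ioo 0 T := fun s hs => ⟨ht'.trans_lt hs.1, hs.2.trans_lt ht⟩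
  rw [h.integral_mul_molRep_sub hθ₀ hk hw hCw ht' htt ht, ← MeasureTheory.integral_const_mul, ← Real.norm_eq_abs]
  refine norm_integral_le_of_norm_le ((hbi.mono_set hsub).const_mul Cw) ?_
  refine ae_restrict_of_ae_restrict_of_subset hsub ?_
  filter_upwards [hGb] with s hs
  rw [Real.norm_eq_abs]
  calc |∫ x, w x * ∫ y, θ s y * (-⟪u s y, FunctionSpaces.Torus.gradient k (x - y)⟫_ℝ + κ * FunctionSpaces.Torus.laplacian k (x - y))|
      ≤ ∫ x, |w x * ∫ y, θ s y * (-⟪u s y, FunctionSpaces.Torus.gradient k (x - y)⟫_ℝ + κ * FunctionSpaces.Torus.laplacian k (x - y))| :=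
        abs_integral_le_integral_abs
    _ ≤ ∫ _ : UnitAddTorus d, Cw * bound s := by
        refine integral_mono_of_nonneg (Eventually.of_forall fun x => abs_nonneg _) (integrable_const _)
          (Eventually.of_forall fun x => ?_)
        dsimp only
        rw [abs_mul]
        exact mul_le_mul (hCw x) (by simpa [Real.norm_eq_abs] using hs x) (abs_nonneg _) hCw0
    _ = Cw * bound s := by simp

end IsWeakScalarTransportOn



end Torus

end Literature.Analysis.FluidPDE
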